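import Literature.NumberTheory.ComplexMultiplication.MainTheoremCMModelReduction
import Literature.NumberTheory.ComplexMultiplication.MainTheoremCMLevelStructure
import Literature.NumberTheory.ComplexMultiplication.MainTheoremCMLevelGluingHolds
import Literature.NumberTheory.ComplexMultiplication.CMDefinedOverQbarHolds
import Literature.NumberTheory.ComplexMultiplication.CMBalancedDivisorFiniteExtensionHolds
import Literature.NumberTheory.ComplexMultiplication.ShimuraTaniyamaPairDegOnePrimeHolds
import Summits.HodgeConjecture.HodgeConjecture.Theorems.HCCMUnconditionalS5cPrimeHolds
import HarnessLib

/-!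
# [Shimura1998] Thm. 18.6 (the Main Theorem of Complex Multiplication, row II-1) is a THEOREM — no binder

Cell `hodgecm-mathlib` (D-0151 release track), row II-1 CLOSER (director g4 BATCH 121 (1) / RULING s37; ref2 VERDICT 11:41:25Z «debt −1»;
B-p10 consult e3927a9d: the same join is the inner term of the floor's `h21` leg, `hc_cm_of_floor_v8` :251–255).  THEOREMS ONLY
(0 def / 0 fact / 0 sorry), tree imports only — the v2w head `shimura1998_thm18_6_holds` of the fan-B line
`Cruxes/H21/Lines/b2_main_theorem_cm.lean` with every workfile-local name replaced by its tree name; the whole chain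
(`…_holds_of_stubs → _degOne → _degOneUnr → _degOneUnr_Q5` + `factS2degOneUnr_holds` + `factQ5_holds`) collapses to ONE tree join:

* S7c ∘ (S7a, S7b): `shimura1998_thm18_6_of_levelStructure` (`MainTheoremCMLevelUniformization`) at S7c `modelReduction_holds`
  (`MainTheoremCMModelReduction`, B-p06) and S7b `levelGluing_holds` (`MainTheoremCMLevelGluingHolds`, B-p12);
* row II-2 `shimura1998_prop26_definedOverNumberField_holds` (`CMDefinedOverQbarHolds`, A-p14);
* S5b `exists_balancedDivisor_finiteExtension_holds` (`CMBalancedDivisorFiniteExtensionHolds`, A-p02 over B-p06);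
* S7a `levelStructure_of_facts_degOne''` (`MainTheoremCMLevelStructure`, edition E1′ ∘ E4) fed by row II-2, the UNRAMIFIED degree-one
  Shimura–Taniyama theorem `shimuraTaniyamaPair_degOne'_holds` (`ShimuraTaniyamaPairDegOnePrimeHolds`, the E2 height-one road) and
  S5c′ `Hyp21.factRHS5c_holds` (`Theorems/HCCMUnconditionalS5cPrimeHolds`, B-p20: the bridge ★ p622510 at Q5 PROVED
  `IsAbelianSchemeModel.forall_isTateCompatible_homReduction_conjFrob_tateSpecialisation_holds`, edition E4 «S5c′ ↦ Q5 ↦ ∅»).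

`#print axioms shimura1998_thm18_6_holds` = {propext, Classical.choice, Quot.sound}.  `--supports stmt-HodgeConjecture-24834`.
HC_CM is proved only modulo the 7 printed citations until rung 0 closes; row II-1 is not one of the 7 binders (it feeds `h21`).

## References
* [Shimura1998] G. Shimura, *Abelian Varieties with Complex Multiplication and Modular Functions*, Princeton Univ. Press 1998:
  §18.6 Thm. 18.6 (pp. 124–125) and its proof (pp. 127–130, 164–169); §13.1 Thm. 1 (i); §13.2; §11.1 Prop. 12, Prop. 14 (i);
  §12.4 Prop. 26; §6.2 Thm. 4 (3); §4.1 Prop. 10.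
* [SerreTate1968] J.-P. Serre, J. Tate, *Good reduction of abelian varieties*, Ann. of Math. 88 (1968), §1 Lemma 2, Thm. 1.
-/

set_option autoImplicit false

-- mandated namespace `Summit.HodgeConjecture.HodgeConjecture.Theorems` trips `linter.dupNamespace` (single-problem summit); off as in
-- `HCCMUnconditionalOfFloorPart2.lean`.
set_option linter.dupNamespace false

noncomputable section

namespace Summit.HodgeConjecture.HodgeConjecture.Theorems

open Literature.NumberTheory.ComplexMultiplication

/-- **S7a BY NAME — the level structure of [Shimura1998] §18.6 holds**: `levelStructure` from row II-2
(`shimura1998_prop26_definedOverNumberField_holds`), the unramified degree-one Shimura–Taniyama theorem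
(`shimuraTaniyamaPair_degOne'_holds`, §13.1 Thm. 1 (i) at `N𝔭 = p`, `p ∤ d(K)`) and S5c′ (`Hyp21.factRHS5c_holds`: cofinite produced
good-reduction data with Tate-compatible homomorphism reductions to and from the Frobenius conjugate, Q5 proved), through the
E1′ ∘ E4 closer `levelStructure_of_facts_degOne''`.
[cite: Shimura1998, §18.6 proof of Thm. 18.6, pp. 128–130 and 164–169; §13.1 Thm. 1 (i); §11.1 Prop. 12 and Prop. 14 (i)] -/
theorem shimura1998_levelStructure_holds : levelStructure :=
  levelStructure_of_facts_degOne'' shimura1998_prop26_definedOverNumberField_holds shimuraTaniyamaPair_degOne'_holds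
    Summit.HodgeConjecture.CorCM.Hyp21.factRHS5c_holds

/-- **[Shimura1998] Thm. 18.6 — the Main Theorem of Complex Multiplication (row II-1) — holds, with NO hypothesis**:
S7c `modelReduction_holds` at row II-2 `shimura1998_prop26_definedOverNumberField_holds`, S5b `exists_balancedDivisor_finiteExtension_holds`,
S7a `shimura1998_levelStructure_holds` and S7b `levelGluing_holds`, joined by `shimura1998_thm18_6_of_levelStructure` — the v2w head of
the fan-B line `b2_main_theorem_cm` with every input a tree theorem.
[cite: Shimura1998, §18.6 Thm. 18.6 pp. 124–125, proof pp. 127–130 and 164–169] -/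
theorem shimura1998_thm18_6_holds : shimura1998_thm18_6 :=
  shimura1998_thm18_6_of_levelStructure modelReduction_holds shimura1998_prop26_definedOverNumberField_holds
    exists_balancedDivisor_finiteExtension_holds shimura1998_levelStructure_holds levelGluing_holds

#print axioms shimura1998_thm18_6_holds

end Summit.HodgeConjecture.HodgeConjecture.Theorems

end
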